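import Summits.QuantumFields.YangMills.Theorems.ColdStartUniversalityLatticeLangevinTimeDecorrelationUniform
import Summits.QuantumFields.YangMills.Theorems.ColdStartUniversalityLatticeLangevinDiscreteSampling
import HarnessLib

/-!
# Route `ColdStartUniversality` (fixed-cut-off SZZ dynamics): ★★★ VOLUME-FREE MEAN-SQUARE ERROR OF THE DISCRETELY SAMPLED COLD-START ESTIMATOR
# for local observables at strong coupling `|β'| < 1/12`

Helper file (seat `ym-line-csu-p1`, g33; `--supports stmt-QuantumFields-24809`).  File 54 bounds `E[(N⁻¹Σ_(k<N) G(U_(kh)) − μG)²]` by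
`(4 + 4Ce^(−ch)/(1−e^(−ch)))/N` with Harris constants `C, c` (volume-dependent).  For a LOCAL `C⁵` observable `f∘coords` (link-Lipschitz profile `ℓ`
supported in `Λ`, `|f∘coords| ≤ M`) at `|β'| < 1/12`, the volume-free two-time bound of file 50
(`abs_twoTime_centered_le_uniform_of_linkLipschitz`: `|E[F(U_s)(f(U_(s+t)) − μf)]| ≤ B·C_f·e^(−ρt/2)`, `C_f = 12π#Λ√(Σℓ²)(6(7+6λ/ρ)³+2)`, `ρ = 1−12|β'|`)
feeds the generic variance-of-sums lemma of file 54 (`integral_sq_sum_le_of_twoTime`): for EVERY strong solution from a deterministic start on ANY space,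
EVERY torus size `L`, every step `h > 0` and every `N ≥ 1`,
* ★★★ `integral_sq_average_sub_wilson_le_uniform_of_linkLipschitz` —
  `E[(N⁻¹ Σ_(k<N) f∘coords(U_(kh)) − μ_(β')(f∘coords))²] ≤ (4M² + 4M·C_f·e^(−ρh/2)/(1 − e^(−ρh/2)))/N` — INDEPENDENT OF THE VOLUME.
THEOREMS ONLY, no definition, no sorry; [folklore].  HONEST FRAMING: fixed cut-off, fixed `|β'| < 1/12`; `UniformColdStartMixing` (24809) is NOT restated;
no crux, rung or summit statement is proved; the Yang–Mills mass gap is NOT proved.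
-/

set_option autoImplicit false

noncomputable section

namespace Summit.QuantumFields.YangMills.Theorems.ColdStartUniversality.LiebRobinson

open MeasureTheory ProbabilityTheory Matrix Complex Finset Filter Set Metric
open scoped ComplexConjugate BigOperators Matrix NNReal ENNReal Topology
open Literature.Probability.Process Literature.MathematicalPhysics.QuantumFieldTheory
open Literature.MathematicalPhysics.QuantumFieldTheory.Balaban1983to89
open Literature.MathematicalPhysics.QuantumLattice (fundamentalRep fundamentalLatticeRep continuous_fundamentalRep fundamentalRep_apply)

variable {L : ℕ} [NeZero L]

/-- ★★★ **Volume-free mean-square error of the discretely sampled estimator, local observables, `|β'| < 1/12`.**  For every torus size `L`, every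
strong solution `U` from a deterministic start on any space, every `C⁵` local observable `f` with link-Lipschitz profile `ℓ ≥ 0` supported in `Λ` and
`|f∘coords| ≤ M`, every step `h > 0` and every `N ≥ 1`:
`E[(N⁻¹ Σ_(k<N) f∘coords(U_(kh)) − μ_(β')(f∘coords))²] ≤ (4M² + 4M·C_f·r/(1 − r))/N`, `r = e^(−ρh/2)`, `C_f = 12π#Λ√(Σℓ²)(6(7+6λ/ρ)³+2)`,
`ρ = 1 − 12|β'|`. [folklore] -/
theorem integral_sq_average_sub_wilson_le_uniform_of_linkLipschitz (L : ℕ) [NeZero L] (β' : ℝ) (hβ : |β'| < 1 / 12)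
    (x : GaugeConfig 3 L (Matrix.specialUnitaryGroup (Fin 2) ℂ))
    {Ω : Type} [MeasurableSpace Ω] {P : Measure Ω} [IsProbabilityMeasure P]
    {W : ℝ≥0 → Ω → (Edge 3 L × NoiseIdx 2 → ℝ)} (hW : IsFlatBrownian W P)
    {U : ℝ≥0 → Ω → GaugeConfig 3 L (Matrix.specialUnitaryGroup (Fin 2) ℂ)} (hU0 : ∀ ω, U 0 ω = x)
    (hU : (latticeLangevinDynamics (fundamentalLatticeRep 2) β').IsSolution (fundamentalRep (Fin 2)) hW.natFiltration P W U)
    {f : (Edge 3 L × Fin 2 × Fin 2 × Bool → ℝ) → ℝ} (hf : ContDiff ℝ 5 f) (Λ : Finset (Edge 3 L)) {ℓ : Edge 3 L → ℝ} (hℓ : ∀ e, 0 ≤ ℓ e)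
    (hℓΛ : ∀ e, e ∉ Λ → ℓ e = 0) {M : ℝ} {h : ℝ≥0} (hh : 0 < h) {N : ℕ} (hN : 1 ≤ N) :
    let coords : GaugeConfig 3 L (Matrix.specialUnitaryGroup (Fin 2) ℂ) → (Edge 3 L × Fin 2 × Fin 2 × Bool → ℝ) :=
      fun V q => (fun z : ℂ => if q.2.2.2 then z.im else z.re)
        ((fundamentalRep (Fin 2) (V q.1) : Matrix (Fin 2) (Fin 2) ℂ) q.2.1 q.2.2.1)
    (∀ (e : Edge 3 L) (y y' : (GaugeConfig 3 L (Matrix.specialUnitaryGroup (Fin 2) ℂ))), (∀ g, g ≠ e → y g = y' g) →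
      |f (coords y) - f (coords y')| ≤ ℓ e * frobNorm ((y e : Matrix (Fin 2) (Fin 2) ℂ) - (y' e : Matrix (Fin 2) (Fin 2) ℂ))) →
    (∀ y : (GaugeConfig 3 L (Matrix.specialUnitaryGroup (Fin 2) ℂ)), |f (coords y)| ≤ M) →
    ∫ ω, ((N : ℝ)⁻¹ * (∑ k ∈ Finset.range N, f (coords (U ((k : ℝ≥0) * h) ω))) -
        ∫ y, f (coords y) ∂(wilsonMeasure (d := 3) (L := L) (fundamentalRep (Fin 2)) β')) ^ 2 ∂P ≤
      (4 * M ^ 2 + 4 * M * (12 * Real.pi * Λ.card * Real.sqrt (∑ e : Edge 3 L, ℓ e ^ 2) *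
          (6 * (7 + 6 * ((1300 + 4 * Real.sqrt 2) * |β'|) / (1 - 12 * |β'|)) ^ 3 + 2)) *
        Real.exp (-((1 - 12 * |β'|) / 2 * h)) / (1 - Real.exp (-((1 - 12 * |β'|) / 2 * h)))) / N := by
  intro coords hLip hM
  classical
  haveI := secondCountableTopology_su2
  haveI := borelSpace_config L
  haveI : IsProbabilityMeasure (wilsonMeasure (d := 3) (L := L) (fundamentalRep (Fin 2)) β') :=
    isProbabilityMeasure_wilsonMeasure (d := 3) (L := L) (fundamentalRep (Fin 2)) (continuous_fundamentalRep (Fin 2)) β'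
  set Cf : ℝ := 12 * Real.pi * Λ.card * Real.sqrt (∑ e : Edge 3 L, ℓ e ^ 2) * (6 * (7 + 6 * ((1300 + 4 * Real.sqrt 2) * |β'|) / (1 - 12 * |β'|)) ^ 3 + 2) with hCf
  set ρ : ℝ := 1 - 12 * |β'| with hρ
  have hρ0 : 0 < ρ := by rw [hρ]; linarith
  have hCf0 : 0 ≤ Cf := by
    rw [hCf]
    have h7 : 0 ≤ 7 + 6 * ((1300 + 4 * Real.sqrt 2) * |β'|) / (1 - 12 * |β'|) := by positivity
    positivity
  set m : ℝ := ∫ y, f (coords y) ∂(wilsonMeasure (d := 3) (L := L) (fundamentalRep (Fin 2)) β') with hm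
  have hco : Continuous coords := continuous_coords (L := L)
  have hGm : Measurable fun y : (GaugeConfig 3 L (Matrix.specialUnitaryGroup (Fin 2) ℂ)) => f (coords y) := (hf.continuous.comp hco).measurable
  have hM0 : 0 ≤ M := (abs_nonneg _).trans (hM x)
  have hm1 : |m| ≤ M := by
    have hh' := norm_integral_le_of_norm_le_const (μ := wilsonMeasure (d := 3) (L := L) (fundamentalRep (Fin 2)) β')
      (f := fun y => f (coords y)) (C := M) (Eventually.of_forall fun y => by simpa [Real.norm_eq_abs] using hM y)
    simpa [Real.norm_eq_abs] using hh'
  have hmU : ∀ u : ℝ≥0, Measurable (U u) := fun u => (hU.adapted u).mono (hW.natFiltration.le u) le_rfl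
  -- the centred samples, `|g| ≤ 2M`
  set g : ℕ → Ω → ℝ := fun k ω => f (coords (U ((k : ℝ≥0) * h) ω)) - m with hgdef
  have hgm : ∀ k, Measurable (g k) := fun k => (hGm.comp (hmU _)).sub measurable_const
  have hFb : ∀ z : (GaugeConfig 3 L (Matrix.specialUnitaryGroup (Fin 2) ℂ)), |f (coords z) - m| ≤ 2 * M := fun z =>
    (abs_sub _ _).trans (by linarith [hM z, hm1])
  have hgb : ∀ k ω, |g k ω| ≤ 2 * M := fun k ω => hFb _
  set r : ℝ := Real.exp (-(ρ / 2 * h)) with hr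
  have hr0 : 0 ≤ r := (Real.exp_pos _).le
  have hr1 : r < 1 := by
    rw [hr, Real.exp_lt_one_iff]
    have : (0 : ℝ) < ρ / 2 * h := mul_pos (half_pos hρ0) (by exact_mod_cast hh)
    linarith
  -- two-time decay, volume-free: `|E[g_j g_k]| ≤ 2M·C_f·r^(k−j)`
  have hdec : ∀ j k : ℕ, j ≤ k → |∫ ω, g j ω * g k ω ∂P| ≤ 2 * M * Cf * r ^ (k - j) := by
    intro j k hjk
    have ht : ((k : ℝ≥0) * h) = (j : ℝ≥0) * h + ((k - j : ℕ) : ℝ≥0) * h := by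
      rw [← add_mul, ← Nat.cast_add, Nat.add_sub_cancel' hjk]
    have h1 := abs_twoTime_centered_le_uniform_of_linkLipschitz L β' hβ x hW hU0 hU (hGm.sub measurable_const) hFb hf Λ hℓ hℓΛ
      ((j : ℝ≥0) * h) (((k - j : ℕ) : ℝ≥0) * h) hLip
    rw [← ht] at h1
    have hpow : Real.exp (-((1 - 12 * |β'|) / 2 * ((((k - j : ℕ) : ℝ≥0) * h : ℝ≥0) : ℝ))) = r ^ (k - j) := by
      rw [hr, hρ, ← Real.exp_nat_mul]; congr 1; rw [NNReal.coe_mul, NNReal.coe_natCast]; ring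
    have heq : ∫ ω, g j ω * g k ω ∂P = ∫ ω, (f (coords (U ((j : ℝ≥0) * h) ω)) - m) * (f (coords (U ((k : ℝ≥0) * h) ω)) - m) ∂P := rfl
    rw [heq]
    refine h1.trans (le_of_eq ?_)
    rw [hpow, hCf]; ring
  have hvar := integral_sq_sum_le_of_twoTime hgm hgb (by positivity : (0 : ℝ) ≤ 2 * M * Cf) hr0 hr1 hdec N
  -- centring and normalisation
  have hNpos : (0 : ℝ) < (N : ℝ) := by exact_mod_cast hN
  have hcent : ∀ ω, (N : ℝ)⁻¹ * (∑ k ∈ Finset.range N, f (coords (U ((k : ℝ≥0) * h) ω))) - m = (N : ℝ)⁻¹ * ∑ k ∈ Finset.range N, g k ω := by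
    intro ω
    have hsum : ∑ k ∈ Finset.range N, g k ω = (∑ k ∈ Finset.range N, f (coords (U ((k : ℝ≥0) * h) ω))) - N * m := by
      simp only [hgdef, Finset.sum_sub_distrib, Finset.sum_const, Finset.card_range, nsmul_eq_mul]
    rw [hsum, mul_sub, ← mul_assoc, inv_mul_cancel₀ hNpos.ne', one_mul]
  calc ∫ ω, ((N : ℝ)⁻¹ * (∑ k ∈ Finset.range N, f (coords (U ((k : ℝ≥0) * h) ω))) - m) ^ 2 ∂P
      = ∫ ω, ((N : ℝ)⁻¹ * ∑ k ∈ Finset.range N, g k ω) ^ 2 ∂P := integral_congr_ae (ae_of_all _ fun ω => by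
          show ((N : ℝ)⁻¹ * (∑ k ∈ Finset.range N, f (coords (U ((k : ℝ≥0) * h) ω))) - m) ^ 2 = ((N : ℝ)⁻¹ * ∑ k ∈ Finset.range N, g k ω) ^ 2
          rw [hcent ω])
    _ = (N : ℝ)⁻¹ ^ 2 * ∫ ω, (∑ k ∈ Finset.range N, g k ω) ^ 2 ∂P := by
        rw [← integral_const_mul]; exact integral_congr_ae (ae_of_all _ fun ω => by ring)
    _ ≤ (N : ℝ)⁻¹ ^ 2 * ((N : ℝ) * ((2 * M) ^ 2 + 2 * (2 * M * Cf) * r / (1 - r))) := mul_le_mul_of_nonneg_left hvar (by positivity)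
    _ = (4 * M ^ 2 + 4 * M * Cf * r / (1 - r)) / N := by field_simp; ring

end Summit.QuantumFields.YangMills.Theorems.ColdStartUniversality.LiebRobinson

end
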